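import Summits.QuantumFields.YangMills.Theorems.BalabanUVNodesPortS1LZdetTwinBridge

/-!
# NODE O port PT-A — THE INDEX EQUIVALENCE OF THE CENTRED LIFT (tool for the integer twins of 27930's line `pta_residueW`, offered to hand-27930-G3C for (ζ) = the twin `EGZ` of the resolvent pieces):
# off the centred wrap class, `(b, a) ↦ (b̂, a)` is a BIJECTION between the non-b₀ fluctuation indices with cube in `X` and the integer fluctuation index `TwinIdx F Mc X̂_K(X)`, along which the
# carrier pieces reindex to the integer pieces and cube predicates transport

Cell `ym-nodeO-ideate`, porter seat `ymgap-nodeO-port-PTA-1` (gen 8); DEFINITION file (one `Equiv` + its transport lemmas), `--supports stmt-QuantumFields-27930`.  [I] = [Balaban1987RG1].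
* ★ `twinIdxEquiv hMc hK X hX : {s : NonB0Idx F k K // □(s) ∈ X} ≃ TwinIdx F Mc (intCubes F Mc k K X)` (`Equiv.ofBijective`: injective by `π_k ∘ lift = id`, onto by ✓`exists_twinLift_preimage`).
* `twinIdxEquiv_apply`, `twinIdxEquiv_symm_bond` (`(e⁻¹ i)`'s bond = `π_k` of `i`'s bond), `twinIdxEquiv_symm_colour`, `blockMap_twinIdxEquiv` (`⌊b̂₋∕(L·Mc)⌋ = valMinAbs □`), `cubeOfSite_twinIdxEquiv_symm`
  (`□(e⁻¹ i) = proj ⌊b̂₋∕(L·Mc)⌋`).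
* ★ `twinMat_lift_apply` ∕ ★★ `twinMat_eq_reindex` — for `Y ⊆ X`: `twinMat … X̂ (X̂_K(Y)) (φ ∘ π) = Matrix.reindex e e (nonB0Block (TY Y φ) restricted to X)` ((Z-bridge) on the cubes of `Y`, (P4-supp)∕(Z-supp) off them) —
  so every matrix word in the pieces (products, inverses, traces: `Matrix.reindex` is a ring isomorphism) has its integer reading.

HONEST FRAMING.  Torus ∕ integer bookkeeping over DISPLAYED clauses of the P0-ℂ body; NOTHING of Bałaban's estimates asserted, ported or discharged; `stub_P0C` ∕ `stub_G3C` ∕ `stub_FE` OPEN; 27930 OPEN · no claim;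
NODE O 0∕1; COUNT 8∕28 · K 1∕4 UNMOVED; finite `𝕋⁴_{L^K}` at fixed ε — NOT continuum ∕ OS ∕ Clay; **the Yang–Mills mass gap is NOT proved by any of this.**  No `sorry`, no `instance`, no `notation`; standard axioms.
-/

noncomputable section

open scoped BigOperators Matrix.Norms.L2Operator
open Finset

namespace Summit.QuantumFields.YangMills.Theorems.BalabanUVNodesPortS1

open Summit.QuantumFields.YangMills.Theorems.K0RecordFormatNames
open Literature.MathematicalPhysics.QuantumFieldTheory.Balaban1983to89
open Literature.MathematicalPhysics.QuantumFieldTheory.Balaban1983to89.Node00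
open Literature.MathematicalPhysics.QuantumFieldTheory.Balaban1983to89.T4Continuum (T4Family)
open Literature.MathematicalPhysics.QuantumFieldTheory.Balaban1983to89.TreeLengthTorus (TPt IsTDom proj)
open Literature.MathematicalPhysics.QuantumLattice (blockMap blockSites mem_blockSites_iff)

variable {F : T4Family}

/-! ## §1  The bijection -/

/-- **The index lift is injective** (`π_k ∘ lift = id`). [cite: Balaban1987RG1, (1.21) p.264 (bookkeeping)] -/
theorem twinLift_injective {Mc k K : ℕ} (hMc : McGuard F Mc) (hK : recordK₀ F Mc k ≤ K) (X : (recordDomSys F Mc k K).Dom) :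
    Function.Injective (fun s : {s : NonB0Idx F k K // cubeOfSite F Mc k K (blockOf s.1.1.src) ∈ (X.1 : Finset (TPt (F.P K).d (Sect2.domCount (F.P K) Mc (k + 1))))} =>
      ((s.1.1.2, ⟨twinLiftBond F Mc k K s.1.1.1, twinLiftBond_mem_twinBonds hMc hK X s.1 s.2⟩) : TwinIdx F Mc (intCubes F Mc k K X))) := by
  intro s t h
  have hcol : s.1.1.2 = t.1.1.2 := congrArg Prod.fst h
  have hbond : twinLiftBond F Mc k K s.1.1.1 = twinLiftBond F Mc k K t.1.1.1 := congrArg Subtype.val (congrArg Prod.snd h)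
  have hb : s.1.1.1 = t.1.1.1 := by
    rw [← coverBondAt_twinLiftBond hMc hK s.1.1.1, ← coverBondAt_twinLiftBond hMc hK t.1.1.1, hbond]
  exact Subtype.ext (Subtype.ext (Prod.ext hb hcol))

/-- **The index lift is onto**, off the centred wrap class. [cite: Balaban1987RG1, (1.21) p.264 (bookkeeping)] -/
theorem twinLift_surjective {Mc k K : ℕ} (hMc : McGuard F Mc) (hK : recordK₀ F Mc k ≤ K) (X : (recordDomSys F Mc k K).Dom) (hX : X ∉ recordWrapCtr F Mc k K) :
    Function.Surjective (fun s : {s : NonB0Idx F k K // cubeOfSite F Mc k K (blockOf s.1.1.src) ∈ (X.1 : Finset (TPt (F.P K).d (Sect2.domCount (F.P K) Mc (k + 1))))} =>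
      ((s.1.1.2, ⟨twinLiftBond F Mc k K s.1.1.1, twinLiftBond_mem_twinBonds hMc hK X s.1 s.2⟩) : TwinIdx F Mc (intCubes F Mc k K X))) := by
  rintro ⟨a, ⟨b, hb⟩⟩
  obtain ⟨t, ht, htX, htb⟩ := exists_twinLift_preimage hMc hK hX hb
  exact ⟨⟨⟨(t, a), ht⟩, htX⟩, Prod.ext rfl (Subtype.ext htb)⟩

/-- ★ **THE INDEX EQUIVALENCE OF THE CENTRED LIFT**: off the centred wrap class, `(b, a) ↦ (b̂, a)` is a bijection between the non-b₀ fluctuation indices with cube in `X` and `TwinIdx F Mc X̂_K(X)`.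
[cite: Balaban1987RG1, (1.21) p.264, (2.11) p.267] -/
def twinIdxEquiv {Mc k K : ℕ} (hMc : McGuard F Mc) (hK : recordK₀ F Mc k ≤ K) (X : (recordDomSys F Mc k K).Dom) (hX : X ∉ recordWrapCtr F Mc k K) :
    {s : NonB0Idx F k K // cubeOfSite F Mc k K (blockOf s.1.1.src) ∈ (X.1 : Finset (TPt (F.P K).d (Sect2.domCount (F.P K) Mc (k + 1))))} ≃ TwinIdx F Mc (intCubes F Mc k K X) :=
  Equiv.ofBijective _ ⟨twinLift_injective hMc hK X, twinLift_surjective hMc hK X hX⟩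

/-! ## §2  Transport lemmas -/

/-- The equivalence on an index (`rfl`). [cite: Balaban1987RG1, (1.21) p.264 (bookkeeping)] -/
theorem twinIdxEquiv_apply {Mc k K : ℕ} (hMc : McGuard F Mc) (hK : recordK₀ F Mc k ≤ K) (X : (recordDomSys F Mc k K).Dom) (hX : X ∉ recordWrapCtr F Mc k K)
    (s : {s : NonB0Idx F k K // cubeOfSite F Mc k K (blockOf s.1.1.src) ∈ (X.1 : Finset (TPt (F.P K).d (Sect2.domCount (F.P K) Mc (k + 1))))}) :
    twinIdxEquiv hMc hK X hX s = (s.1.1.2, ⟨twinLiftBond F Mc k K s.1.1.1, twinLiftBond_mem_twinBonds hMc hK X s.1 s.2⟩) := rfl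

/-- **The inverse on bonds**: the torus bond of `e⁻¹ i` is the cover `π_k` of the integer bond of `i`. [cite: Balaban1987RG1, (1.21) p.264 (bookkeeping)] -/
theorem twinIdxEquiv_symm_bond {Mc k K : ℕ} (hMc : McGuard F Mc) (hK : recordK₀ F Mc k ≤ K) (X : (recordDomSys F Mc k K).Dom) (hX : X ∉ recordWrapCtr F Mc k K)
    (i : TwinIdx F Mc (intCubes F Mc k K X)) : ((twinIdxEquiv hMc hK X hX).symm i).1.1.1 = coverBondAt (F.P K) k i.2.1 := by
  have h := (twinIdxEquiv hMc hK X hX).apply_symm_apply i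
  rw [twinIdxEquiv_apply] at h
  have hb : twinLiftBond F Mc k K ((twinIdxEquiv hMc hK X hX).symm i).1.1.1 = i.2.1 := congrArg Subtype.val (congrArg Prod.snd h)
  rw [← hb, coverBondAt_twinLiftBond hMc hK]

/-- **The inverse on colours**. [cite: Balaban1987RG1, (2.11) p.267 (bookkeeping)] -/
theorem twinIdxEquiv_symm_colour {Mc k K : ℕ} (hMc : McGuard F Mc) (hK : recordK₀ F Mc k ≤ K) (X : (recordDomSys F Mc k K).Dom) (hX : X ∉ recordWrapCtr F Mc k K)
    (i : TwinIdx F Mc (intCubes F Mc k K X)) : ((twinIdxEquiv hMc hK X hX).symm i).1.1.2 = i.1 := by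
  have h := (twinIdxEquiv hMc hK X hX).apply_symm_apply i
  rw [twinIdxEquiv_apply] at h
  exact congrArg Prod.fst h

/-- **The `L·Mc`-block of the lifted bond is the centred representative of the cube.** [cite: Balaban1987RG1, (1.21) p.264 (bookkeeping)] -/
theorem blockMap_twinIdxEquiv {Mc k K : ℕ} (hMc : McGuard F Mc) (hK : recordK₀ F Mc k ≤ K) (X : (recordDomSys F Mc k K).Dom) (hX : X ∉ recordWrapCtr F Mc k K)
    (s : {s : NonB0Idx F k K // cubeOfSite F Mc k K (blockOf s.1.1.src) ∈ (X.1 : Finset (TPt (F.P K).d (Sect2.domCount (F.P K) Mc (k + 1))))}) :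
    blockMap (F.L * Mc) (twinIdxEquiv hMc hK X hX s).2.1.1 = fun i => ((cubeOfSite F Mc k K (blockOf s.1.1.1.src) i).valMinAbs : ℤ) := by
  rw [twinIdxEquiv_apply]
  exact blockMap_twinLiftSite hMc s.1.1.1.src

/-- **The cube of the inverse is the projection of the integer bond's `L·Mc`-block.** [cite: Balaban1987RG1, (1.21) p.264, p.257 (bookkeeping)] -/
theorem cubeOfSite_twinIdxEquiv_symm {Mc k K : ℕ} (hMc : McGuard F Mc) (hK : recordK₀ F Mc k ≤ K) (X : (recordDomSys F Mc k K).Dom) (hX : X ∉ recordWrapCtr F Mc k K)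
    (i : TwinIdx F Mc (intCubes F Mc k K X)) :
    cubeOfSite F Mc k K (blockOf ((twinIdxEquiv hMc hK X hX).symm i).1.1.1.src) = proj (Sect2.domCount (F.P K) Mc (k + 1)) (blockMap (F.L * Mc) i.2.1.1) := by
  have hk : k + 1 ≤ (F.P K).m + (F.P K).K := succ_le_m_add_K_of_recordK₀_le hK
  rw [twinIdxEquiv_symm_bond hMc hK X hX i]
  show cubeOfSite F Mc k K (blockOf (coverAt (F.P K) k i.2.1.1)) = _
  rw [blockOf_coverAt hk, cubeOfSite_coverAt hMc hK, blockMap_blockMap (P := F.P K)]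
  rfl

/-- ★ **ENTRIES ALONG THE LIFT**: for `Y ⊆ X` (off the wrap class) and indices `a, b` with cube in `X`, `TZY (X̂_K(Y)) (φ ∘ π) (lift a) (lift b) = TY Y φ a b` ((Z-bridge) when both cubes lie in `Y`, else both sides
vanish by (P4-supp) ∕ (Z-supp)). [cite: Balaban1987RG1, (1.21) p.264, (1.7) p.261] -/
theorem twinMat_lift_apply {Mc k K : ℕ} (hMc : McGuard F Mc) (hK : recordK₀ F Mc k ≤ K) {X : (recordDomSys F Mc k K).Dom} (hX : X ∉ recordWrapCtr F Mc k K)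
    (TYK : (recordDomSys F Mc k K).Dom → Sect2.CPair (F.P K) (MatA 2) → FluctIdx F k K → FluctIdx F k K → ℂ)
    (TZY : Finset (Fin 4 → ℤ) → IntBondCfg → ((Fin 4 → ℤ) × Fin 4) × Fin 3 → ((Fin 4 → ℤ) × Fin 4) × Fin 3 → ℂ) (φ : Sect2.CPair (F.P K) (MatA 2))
    (hZsupp : ∀ (Xh : Finset (Fin 4 → ℤ)) (f : IntBondCfg) (bi bj : (Fin 4 → ℤ) × Fin 4) (a a' : Fin 3),
      (blockMap (F.L * Mc) bi.1 ∉ Xh ∨ blockMap (F.L * Mc) bj.1 ∉ Xh) → TZY Xh f (bi, a) (bj, a') = 0)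
    (hZbr : ∀ (Y : (recordDomSys F Mc k K).Dom), Y ∉ recordWrapCtr F Mc k K →
      ∀ (ψ : Sect2.CPair (F.P K) (MatA 2)) (bi bj : (Fin 4 → ℤ) × Fin 4) (a a' : Fin 3),
        blockMap (F.L * Mc) bi.1 ∈ intCubes F Mc k K Y → blockMap (F.L * Mc) bj.1 ∈ intCubes F Mc k K Y →
          TYK Y ψ (coverBondAt (F.P K) k bi, a) (coverBondAt (F.P K) k bj, a') = TZY (intCubes F Mc k K Y) (pullPair F K ψ) (bi, a) (bj, a'))
    (hsupp : ∀ Y ψ (s s' : NonB0Idx F k K),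
      (cubeOfSite F Mc k K (blockOf s.1.1.src) ∉ (Y.1 : Finset (TPt (F.P K).d (Sect2.domCount (F.P K) Mc (k + 1)))) ∨
        cubeOfSite F Mc k K (blockOf s'.1.1.src) ∉ (Y.1 : Finset (TPt (F.P K).d (Sect2.domCount (F.P K) Mc (k + 1))))) → TYK Y ψ s.1 s'.1 = 0)
    {Y : (recordDomSys F Mc k K).Dom} (hYX : (Y.1 : Finset (TPt (F.P K).d (Sect2.domCount (F.P K) Mc (k + 1)))) ⊆ X.1)
    (a b : {s : NonB0Idx F k K // cubeOfSite F Mc k K (blockOf s.1.1.src) ∈ (X.1 : Finset (TPt (F.P K).d (Sect2.domCount (F.P K) Mc (k + 1))))}) :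
    twinMat F Mc TZY (intCubes F Mc k K X) (intCubes F Mc k K Y) (pullPair F K φ) (twinIdxEquiv hMc hK X hX a) (twinIdxEquiv hMc hK X hX b) = TYK Y φ a.1.1 b.1.1 := by
  have he_inj : Function.Injective (fun (c : TPt (F.P K).d (Sect2.domCount (F.P K) Mc (k + 1))) (i : Fin 4) => (c i).valMinAbs) :=
    valMinAbs_lift_injective (Sect2.domCount (F.P K) Mc (k + 1))
  have hYw : Y ∉ recordWrapCtr F Mc k K := not_mem_recordWrapCtr_of_subset hX hYX
  rw [twinIdxEquiv_apply, twinIdxEquiv_apply]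
  show TZY (intCubes F Mc k K Y) (pullPair F K φ) (twinLiftBond F Mc k K a.1.1.1, a.1.1.2) (twinLiftBond F Mc k K b.1.1.1, b.1.1.2) = TYK Y φ a.1.1 b.1.1
  by_cases hab : cubeOfSite F Mc k K (blockOf a.1.1.1.src) ∈ (Y.1 : Finset _) ∧ cubeOfSite F Mc k K (blockOf b.1.1.1.src) ∈ (Y.1 : Finset _)
  · have ha : blockMap (F.L * Mc) (twinLiftBond F Mc k K a.1.1.1).1 ∈ intCubes F Mc k K Y := by
      show blockMap (F.L * Mc) (twinLiftSite F Mc k K a.1.1.1.src) ∈ _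
      rw [blockMap_twinLiftSite hMc]; exact Finset.mem_image_of_mem _ hab.1
    have hb : blockMap (F.L * Mc) (twinLiftBond F Mc k K b.1.1.1).1 ∈ intCubes F Mc k K Y := by
      show blockMap (F.L * Mc) (twinLiftSite F Mc k K b.1.1.1.src) ∈ _
      rw [blockMap_twinLiftSite hMc]; exact Finset.mem_image_of_mem _ hab.2
    have h := hZbr Y hYw φ _ _ a.1.1.2 b.1.1.2 ha hb
    rw [coverBondAt_twinLiftBond hMc hK, coverBondAt_twinLiftBond hMc hK] at h
    exact h.symm
  · have hzero : TYK Y φ a.1.1 b.1.1 = 0 := hsupp Y φ a.1 b.1 (not_and_or.1 hab)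
    rw [hzero]
    refine hZsupp _ _ _ _ _ _ ?_
    rcases not_and_or.1 hab with h | h
    · left
      show blockMap (F.L * Mc) (twinLiftSite F Mc k K a.1.1.1.src) ∉ _
      rw [blockMap_twinLiftSite hMc]
      exact fun hm => h (by obtain ⟨c, hc, hce⟩ := Finset.mem_image.1 hm; exact he_inj hce ▸ hc)
    · right
      show blockMap (F.L * Mc) (twinLiftSite F Mc k K b.1.1.1.src) ∉ _
      rw [blockMap_twinLiftSite hMc]
      exact fun hm => h (by obtain ⟨c, hc, hce⟩ := Finset.mem_image.1 hm; exact he_inj hce ▸ hc)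

/-- ★★ **THE INTEGER PIECE IS THE REINDEXED TORUS PIECE**: for `Y ⊆ X` off the wrap class, `twinMat … X̂ (X̂_K(Y)) (φ ∘ π) = Matrix.reindex e e (Matrix.of (a b ↦ TY Y φ a b))` on the indices with cube in `X`
(so products, inverses and traces of the torus words reindex to those of the integer words: `Matrix.reindex` along an `Equiv` is a ring isomorphism). [cite: Balaban1987RG1, (1.21) p.264, (1.7) p.261] -/
theorem twinMat_eq_reindex {Mc k K : ℕ} (hMc : McGuard F Mc) (hK : recordK₀ F Mc k ≤ K) {X : (recordDomSys F Mc k K).Dom} (hX : X ∉ recordWrapCtr F Mc k K)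
    (TYK : (recordDomSys F Mc k K).Dom → Sect2.CPair (F.P K) (MatA 2) → FluctIdx F k K → FluctIdx F k K → ℂ)
    (TZY : Finset (Fin 4 → ℤ) → IntBondCfg → ((Fin 4 → ℤ) × Fin 4) × Fin 3 → ((Fin 4 → ℤ) × Fin 4) × Fin 3 → ℂ) (φ : Sect2.CPair (F.P K) (MatA 2))
    (hZsupp : ∀ (Xh : Finset (Fin 4 → ℤ)) (f : IntBondCfg) (bi bj : (Fin 4 → ℤ) × Fin 4) (a a' : Fin 3),
      (blockMap (F.L * Mc) bi.1 ∉ Xh ∨ blockMap (F.L * Mc) bj.1 ∉ Xh) → TZY Xh f (bi, a) (bj, a') = 0)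
    (hZbr : ∀ (Y : (recordDomSys F Mc k K).Dom), Y ∉ recordWrapCtr F Mc k K →
      ∀ (ψ : Sect2.CPair (F.P K) (MatA 2)) (bi bj : (Fin 4 → ℤ) × Fin 4) (a a' : Fin 3),
        blockMap (F.L * Mc) bi.1 ∈ intCubes F Mc k K Y → blockMap (F.L * Mc) bj.1 ∈ intCubes F Mc k K Y →
          TYK Y ψ (coverBondAt (F.P K) k bi, a) (coverBondAt (F.P K) k bj, a') = TZY (intCubes F Mc k K Y) (pullPair F K ψ) (bi, a) (bj, a'))
    (hsupp : ∀ Y ψ (s s' : NonB0Idx F k K),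
      (cubeOfSite F Mc k K (blockOf s.1.1.src) ∉ (Y.1 : Finset (TPt (F.P K).d (Sect2.domCount (F.P K) Mc (k + 1)))) ∨
        cubeOfSite F Mc k K (blockOf s'.1.1.src) ∉ (Y.1 : Finset (TPt (F.P K).d (Sect2.domCount (F.P K) Mc (k + 1))))) → TYK Y ψ s.1 s'.1 = 0)
    {Y : (recordDomSys F Mc k K).Dom} (hYX : (Y.1 : Finset (TPt (F.P K).d (Sect2.domCount (F.P K) Mc (k + 1)))) ⊆ X.1) :
    twinMat F Mc TZY (intCubes F Mc k K X) (intCubes F Mc k K Y) (pullPair F K φ) =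
      Matrix.reindex (twinIdxEquiv hMc hK X hX) (twinIdxEquiv hMc hK X hX)
        (Matrix.of fun a b : {s : NonB0Idx F k K // cubeOfSite F Mc k K (blockOf s.1.1.src) ∈ (X.1 : Finset (TPt (F.P K).d (Sect2.domCount (F.P K) Mc (k + 1))))} =>
          TYK Y φ a.1.1 b.1.1) := by
  ext i j
  rw [Matrix.reindex_apply, Matrix.submatrix_apply, Matrix.of_apply]
  conv_lhs => rw [← (twinIdxEquiv hMc hK X hX).apply_symm_apply i, ← (twinIdxEquiv hMc hK X hX).apply_symm_apply j]
  exact twinMat_lift_apply hMc hK hX TYK TZY φ hZsupp hZbr hsupp hYX _ _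

end Summit.QuantumFields.YangMills.Theorems.BalabanUVNodesPortS1

end
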